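import Summits.HodgeConjecture.HodgeConjecture.Theses.HeckePrymWeil
import Summits.HodgeConjecture.HodgeConjecture.Theorems.WeilTwelvefoldsSqrtMinus7.Negative.LadderTyping
import Literature.AlgebraicGeometry.HodgeTheory.WeilClassesFourfoldsStep2
import Literature.AlgebraicGeometry.Motives.AbelianVarietyProjectiveChart
import Literature.AlgebraicGeometry.HodgeTheory.GysinBaseChangeOfKunneth

/-!
# `WeilDescending` (stmt-HodgeConjecture-1263) · I · the upward half of Koike's trick in the route's typing

Route `HeckePrymWeil`, support item `WeilDescending`: for a prime `p ≡ 3 (4)`, `p ≥ 7` and `n ≥ 1`,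
the rung predicate `HWA(p, n+1)` of `HodgeWeilLadder` implies `HWA(p, n)` (Koike's trick,
doi:10.4153/cmb-2004-055-x; Schoen 1998 §10; Markman arXiv:2509.23403 §11.5 Step 2, made
component-free). The printed proof has two halves: (↑) for a rational `(n,n)` Weil class
`c = c₊ + c₋` of `(A, φ)` and a rational `(1,1)` Weil class `w = u₊ + u₋` of a partner surface
`(B, ψ)`, BOTH eigen-components `pr_A^* c± ∪ pr_B^* u±` of the exterior product are algebraic on
`A × B` by `HWA(p, n+1)` applied to the rational Weil projector `q(T)(pr_A^* c ∪ pr_B^* w)`,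
`T = (𝟙 + φ × ψ)^*`; (↓) Schoen's transfer `pr_{A*}(– ∪ pr_B^* η)` returns `c±` algebraic on `A`.

This file PROVES (↑) on the tree's real carriers, in the route's OWN typing — eigenspaces of the
single pull-back `(𝟙 + φ)^*` for the eigenvalues `(1 ± i√p)^{2n}` (not the simultaneous
eigenclasses `weilClassesPlus/Minus` of `Literature/…/WeilClasses`, for which the analogous
statement is `Literature.AlgebraicGeometry.HodgeTheory.weilEigencomponents_cupProduct_mem_algebraicClasses`):

* `map_one_add_cupProduct_fst_snd` — `(𝟙 + Φ)^*(pr_A^* c₁ ∪ pr_B^* c₂) = ab · (pr_A^* c₁ ∪ pr_B^* c₂)`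
  for `(𝟙+φ)^* c₁ = a c₁`, `(𝟙+ψ)^* c₂ = b c₂` and `Φ` over `φ`, `ψ` (naturality of `∪`);
* `weilEigencomponents_mem_algebraicClasses_of_rung` — (↑): with `sp = 1 + i√p`, `sm = 1 - i√p`,
  `p ≥ 4`, `n ≥ 1`, the four pieces of `P = pr_A^*(c₊ + c₋) ∪ pr_B^*(u₊ + u₋)` are `T`-eigenvectors
  for `sp^{2n+2}`, `sm^{2n+2}`, `β = sp^{2n} sm²`, `β' = sm^{2n} sp²`; `Q = (T - β)(T - β') P` and `TQ`
  are RATIONAL (`β + β'`, `ββ' ∈ ℤ`), of type `(n+1, n+1)` (an endomorphism preserves the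
  `(p,q)`-classes of a fixed Hodge model) and lie in `Eig(T, sp^{2n+2}) ⊔ Eig(T, sm^{2n+2})`, hence are
  algebraic by the rung hypothesis; the separations `sp^k ≠ sm^k` (`k = 2, 2n, 2n+2`; Niven, the
  tree's `one_add_I_sqrt_pow_ne`) invert the `2 × 2` system (`mem_and_mem_of_smul_add_smul_mem`).
* bookkeeping: `isSmoothProjective_of_dim_eq` (abelian varieties are smooth projective of dimension
  `A.dim`, the tree's `isSmoothProjective_holds`), `prodLift_comp_self_eq_neg_zsmul`
  (`(φ × ψ)² = -p` in the route's `ℤ`-scalar spelling).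

* `complexGysin_fst_map_snd_ne_zero_of_kunneth` — the topological input of the downward half:
  **fibre integrals of non-zero top classes do not vanish**, `(pr_X)_* pr_Z^* w ≠ 0` in `H⁰(X(ℂ))`
  for `0 ≠ w ∈ H^{2 dim Z}(Z(ℂ))`, along the tree's REAL Gysin morphisms `complexGysin μ`
  (Poincaré duality is the tree's theorem `OrientationFamily.hasPoincareDuality`), GRANTED the
  Künneth spanning property in the top degree of `X × Z` (same device as the tree's
  `exists_complexGysin_map_ne_zero`).

The downward half (Schoen's transfer) and the assembly are in `HeckePrymWeilWeilDescending.lean`.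
-/

noncomputable section

-- every declaration of this problem lives in `Summit.HodgeConjecture.HodgeConjecture.…` (summit = sub-problem)
set_option linter.dupNamespace false

open scoped Manifold
open CategoryTheory MonoidalCategory CartesianMonoidalCategory
open Literature.AlgebraicGeometry Literature.AlgebraicGeometry.HodgeTheory
open Literature.AlgebraicTopology.SingularHomology
open Summit.HodgeConjecture.HodgeConjecture.Theorems.WeilTwelvefoldsSqrtMinus7.Negative
  (one_add_I_sqrt_pow_ne one_add_I_sqrt_ne_zero one_sub_I_sqrt_ne_zero)

namespace Summit.HodgeConjecture.HodgeConjecture.Theorems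

/-- **Abelian varieties are smooth projective of their dimension**, in the route's typing `A.dim = m`
(the tree's `Motives.AbelianVariety.isSmoothProjective_holds`, Mumford §4 (ii), §6 Application 1). -/
theorem isSmoothProjective_of_dim_eq {A : Motives.AbelianVariety ℂ} {m : ℕ} (hA : A.dim = m) :
    Motives.IsSmoothProjective m A.X := by
  have h := Motives.AbelianVariety.isSmoothProjective_holds (A := A)
  rw [Motives.AbelianVariety.isSmoothProjective, hA] at h
  exact h

/-- **`(φ × ψ)² = -p`** for the product endomorphism `φ × ψ = prodLift (fst ≫ φ) (snd ≫ ψ)` of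
`A × B`, in the route's spelling `-((p : ℤ) • 𝟙)` (the tree's `prodLift_comp_self_eq_neg_nsmul`,
Schoen 1998 §10: "the Weil pair associated to the product"). -/
theorem prodLift_comp_self_eq_neg_zsmul {A B : Motives.AbelianVariety ℂ} {p : ℕ} {φ : A ⟶ A} {ψ : B ⟶ B}
    (hφ : φ ≫ φ = -((p : ℤ) • 𝟙 A)) (hψ : ψ ≫ ψ = -((p : ℤ) • 𝟙 B)) :
    Motives.AbelianVariety.prodLift (Motives.AbelianVariety.fst A B ≫ φ)
        (Motives.AbelianVariety.snd A B ≫ ψ) ≫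
      Motives.AbelianVariety.prodLift (Motives.AbelianVariety.fst A B ≫ φ)
        (Motives.AbelianVariety.snd A B ≫ ψ) = -((p : ℤ) • 𝟙 (A.prod B)) := by
  rw [natCast_zsmul] at hφ hψ ⊢
  exact prodLift_comp_self_eq_neg_nsmul hφ hψ

/-- **Exterior products of eigenclasses of `(𝟙+φ)^*`, `(𝟙+ψ)^*` are eigenclasses of `(𝟙+Φ)^*`** for
an endomorphism `Φ` of `A × B` over `φ` and `ψ`: if `(𝟙+φ)^* c₁ = a · c₁` and `(𝟙+ψ)^* c₂ = b · c₂`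
then `(𝟙+Φ)^*(pr_A^* c₁ ∪ pr_B^* c₂) = ab · (pr_A^* c₁ ∪ pr_B^* c₂)` — naturality of the cup product
(Hatcher Prop. 3.10) and `(𝟙+Φ) ≫ pr = pr ≫ (𝟙+φ)` (bilinearity of composition). Single-operator
form of the tree's `cupProduct_map_fst_map_snd_mem_pullbackEigenclasses`. -/
theorem map_one_add_cupProduct_fst_snd {A B : Motives.AbelianVariety ℂ} {k₁ k₂ m : ℕ} (hk : k₁ + k₂ = m)
    {φ : A ⟶ A} {ψ : B ⟶ B} {Φ : A.prod B ⟶ A.prod B}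
    (h₁ : Φ ≫ Motives.AbelianVariety.fst A B = Motives.AbelianVariety.fst A B ≫ φ)
    (h₂ : Φ ≫ Motives.AbelianVariety.snd A B = Motives.AbelianVariety.snd A B ≫ ψ)
    {c₁ : complexBetti A.X k₁} {c₂ : complexBetti B.X k₂} {a b : ℂ}
    (hc₁ : complexBetti.map (𝟙 A + φ).hom.hom.hom k₁ c₁ = a • c₁)
    (hc₂ : complexBetti.map (𝟙 B + ψ).hom.hom.hom k₂ c₂ = b • c₂) :
    complexBetti.map (𝟙 (A.prod B) + Φ).hom.hom.hom m
        (cupProduct hk (complexBetti.map (Motives.AbelianVariety.fst A B).hom.hom.hom k₁ c₁)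
          (complexBetti.map (Motives.AbelianVariety.snd A B).hom.hom.hom k₂ c₂)) =
      (a * b) • cupProduct hk (complexBetti.map (Motives.AbelianVariety.fst A B).hom.hom.hom k₁ c₁)
          (complexBetti.map (Motives.AbelianVariety.snd A B).hom.hom.hom k₂ c₂) := by
  have hf : (𝟙 (A.prod B) + Φ) ≫ Motives.AbelianVariety.fst A B =
      Motives.AbelianVariety.fst A B ≫ (𝟙 A + φ) := by
    simp [Preadditive.add_comp, Preadditive.comp_add, h₁]
  have hs : (𝟙 (A.prod B) + Φ) ≫ Motives.AbelianVariety.snd A B =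
      Motives.AbelianVariety.snd A B ≫ (𝟙 B + ψ) := by
    simp [Preadditive.add_comp, Preadditive.comp_add, h₂]
  have e₁ : complexBetti.map (𝟙 (A.prod B) + Φ).hom.hom.hom k₁
        (complexBetti.map (Motives.AbelianVariety.fst A B).hom.hom.hom k₁ c₁) =
      a • complexBetti.map (Motives.AbelianVariety.fst A B).hom.hom.hom k₁ c₁ := by
    change singularCohomology.map ℂ ℂ _ k₁ (singularCohomology.map ℂ ℂ _ k₁ c₁) = _
    rw [abelianVarietyHom_map_map_apply, hf, ← abelianVarietyHom_map_map_apply]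
    change complexBetti.map _ k₁ (complexBetti.map (𝟙 A + φ).hom.hom.hom k₁ c₁) = _
    rw [hc₁, map_smul]
  have e₂ : complexBetti.map (𝟙 (A.prod B) + Φ).hom.hom.hom k₂
        (complexBetti.map (Motives.AbelianVariety.snd A B).hom.hom.hom k₂ c₂) =
      b • complexBetti.map (Motives.AbelianVariety.snd A B).hom.hom.hom k₂ c₂ := by
    change singularCohomology.map ℂ ℂ _ k₂ (singularCohomology.map ℂ ℂ _ k₂ c₂) = _
    rw [abelianVarietyHom_map_map_apply, hs, ← abelianVarietyHom_map_map_apply]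
    change complexBetti.map _ k₂ (complexBetti.map (𝟙 B + ψ).hom.hom.hom k₂ c₂) = _
    rw [hc₂, map_smul]
  change singularCohomology.map ℂ ℂ _ m (cupProduct hk _ _) = _
  rw [cupProduct_map]
  change cupProduct hk (complexBetti.map (𝟙 (A.prod B) + Φ).hom.hom.hom k₁ _)
    (complexBetti.map (𝟙 (A.prod B) + Φ).hom.hom.hom k₂ _) = _
  rw [e₁, e₂, LinearMap.map_smul₂, map_smul, smul_smul]

/-- **Koike's trick, upward half, in the route's typing (all `n`).** Let `A`, `B` be complex abelian
varieties with endomorphisms `φ`, `ψ`, `Φ` an endomorphism of `A × B` over both, `p ≥ 4`, `n ≥ 1`,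
`A × B` smooth projective of dimension `2(n+1)`, and write `sp = 1 + i√p`, `sm = 1 - i√p`. ASSUME the
rung `HWA(p, n+1)` for `(A × B, Φ)` in the route's shape: every rational class of Hodge type
`(n+1, n+1)` in `Eig((𝟙+Φ)^*, sp^{2(n+1)}) ⊔ Eig((𝟙+Φ)^*, sm^{2(n+1)})` is algebraic. Then for
`(𝟙+φ)^*`-eigenclasses `c₊` (`sp^{2n}`), `c₋` (`sm^{2n}`) on `A` and `(𝟙+ψ)^*`-eigenclasses `u₊` (`sp²`),
`u₋` (`sm²`) on `B` with `c₊ + c₋` and `u₊ + u₋` RATIONAL and `pr_A^*(c₊ + c₋) ∪ pr_B^*(u₊ + u₋)` of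
Hodge type `(n+1, n+1)`, BOTH `pr_A^* c₊ ∪ pr_B^* u₊` and `pr_A^* c₋ ∪ pr_B^* u₋` lie in the
`ℂ`-subspace `algebraicClasses (A × B) (n+1)`. Proof: the rational Weil projector of Schoen's
product step (module docstring), verbatim the argument of the tree's
`weilEigencomponents_cupProduct_mem_algebraicClasses` with the test endomorphism `𝟙 + Φ`. -/
theorem weilEigencomponents_mem_algebraicClasses_of_rung {A B : Motives.AbelianVariety ℂ}
    {φ : A ⟶ A} {ψ : B ⟶ B} {Φ : A.prod B ⟶ A.prod B}
    (h₁ : Φ ≫ Motives.AbelianVariety.fst A B = Motives.AbelianVariety.fst A B ≫ φ)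
    (h₂ : Φ ≫ Motives.AbelianVariety.snd A B = Motives.AbelianVariety.snd A B ≫ ψ)
    {p n : ℕ} (hp : 4 ≤ p) (hn : 1 ≤ n) (h : 2 * n + 2 * 1 = 2 * (n + 1))
    (hBX : Motives.IsSmoothProjective (2 * (n + 1)) (A.prod B).X)
    (hB : ∀ c : complexBetti (A.prod B).X (2 * (n + 1)), IsRationalClass c →
      IsOfHodgeType (2 * (n + 1)) (A.prod B).X (2 * (n + 1)) (n + 1) (n + 1) c →
        c ∈ Module.End.eigenspace (complexBetti.map (𝟙 (A.prod B) + Φ).hom.hom.hom (2 * (n + 1))).hom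
              ((1 + Complex.I * (Real.sqrt (p : ℝ) : ℂ)) ^ (2 * (n + 1))) ⊔
            Module.End.eigenspace (complexBetti.map (𝟙 (A.prod B) + Φ).hom.hom.hom (2 * (n + 1))).hom
              ((1 - Complex.I * (Real.sqrt (p : ℝ) : ℂ)) ^ (2 * (n + 1))) →
          c ∈ algebraicClasses (A.prod B).X (n + 1))
    {cp cm : complexBetti A.X (2 * n)} {up um : complexBetti B.X (2 * 1)}
    (hcp : complexBetti.map (𝟙 A + φ).hom.hom.hom (2 * n) cp =
      (1 + Complex.I * (Real.sqrt (p : ℝ) : ℂ)) ^ (2 * n) • cp)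
    (hcm : complexBetti.map (𝟙 A + φ).hom.hom.hom (2 * n) cm =
      (1 - Complex.I * (Real.sqrt (p : ℝ) : ℂ)) ^ (2 * n) • cm)
    (hup : complexBetti.map (𝟙 B + ψ).hom.hom.hom (2 * 1) up =
      (1 + Complex.I * (Real.sqrt (p : ℝ) : ℂ)) ^ (2 * 1) • up)
    (hum : complexBetti.map (𝟙 B + ψ).hom.hom.hom (2 * 1) um =
      (1 - Complex.I * (Real.sqrt (p : ℝ) : ℂ)) ^ (2 * 1) • um)
    (hr₁ : IsRationalClass (cp + cm)) (hr₂ : IsRationalClass (up + um))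
    (hH : IsOfHodgeType (2 * (n + 1)) (A.prod B).X (2 * (n + 1)) (n + 1) (n + 1)
      (cupProduct h (complexBetti.map (Motives.AbelianVariety.fst A B).hom.hom.hom (2 * n) (cp + cm))
        (complexBetti.map (Motives.AbelianVariety.snd A B).hom.hom.hom (2 * 1) (up + um)))) :
    cupProduct h (complexBetti.map (Motives.AbelianVariety.fst A B).hom.hom.hom (2 * n) cp)
        (complexBetti.map (Motives.AbelianVariety.snd A B).hom.hom.hom (2 * 1) up) ∈
      algebraicClasses (A.prod B).X (n + 1) ∧
    cupProduct h (complexBetti.map (Motives.AbelianVariety.fst A B).hom.hom.hom (2 * n) cm)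
        (complexBetti.map (Motives.AbelianVariety.snd A B).hom.hom.hom (2 * 1) um) ∈
      algebraicClasses (A.prod B).X (n + 1) := by
  -- shorthands
  set sp : ℂ := 1 + Complex.I * (Real.sqrt (p : ℝ) : ℂ) with hsp
  set sm : ℂ := 1 - Complex.I * (Real.sqrt (p : ℝ) : ℂ) with hsm
  set q₁ : complexBetti A.X (2 * n) → complexBetti (A.prod B).X (2 * n) := fun w ↦
    complexBetti.map (Motives.AbelianVariety.fst A B).hom.hom.hom (2 * n) w with hq₁
  set q₂ : complexBetti B.X (2 * 1) → complexBetti (A.prod B).X (2 * 1) := fun w ↦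
    complexBetti.map (Motives.AbelianVariety.snd A B).hom.hom.hom (2 * 1) w with hq₂
  set T : complexBetti (A.prod B).X (2 * (n + 1)) →ₗ[ℂ] complexBetti (A.prod B).X (2 * (n + 1)) :=
    (complexBetti.map (𝟙 (A.prod B) + Φ).hom.hom.hom (2 * (n + 1))).hom with hT
  have hTapp : ∀ c : complexBetti (A.prod B).X (2 * (n + 1)),
      T c = complexBetti.map (𝟙 (A.prod B) + Φ).hom.hom.hom (2 * (n + 1)) c := fun _ ↦ rfl
  have hsp0 : sp ≠ 0 := one_add_I_sqrt_ne_zero p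
  have hsm0 : sm ≠ 0 := one_sub_I_sqrt_ne_zero p
  have hx₁ : sp ^ (2 * n) ≠ sm ^ (2 * n) := one_add_I_sqrt_pow_ne p hp (2 * n) (by omega)
  have hx₂ : sp ^ (2 * 1) ≠ sm ^ (2 * 1) := one_add_I_sqrt_pow_ne p hp (2 * 1) (by omega)
  have hx : sp ^ (2 * (n + 1)) ≠ sm ^ (2 * (n + 1)) := one_add_I_sqrt_pow_ne p hp _ (by omega)
  -- the four pieces of `P = pr₁^* c ∪ pr₂^* w` and their eigenvalues under `T`
  set P : complexBetti (A.prod B).X (2 * (n + 1)) := cupProduct h (q₁ (cp + cm)) (q₂ (up + um))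
    with hPdef
  set P₁ : complexBetti (A.prod B).X (2 * (n + 1)) := cupProduct h (q₁ cp) (q₂ up) with hP₁
  set P₂ : complexBetti (A.prod B).X (2 * (n + 1)) := cupProduct h (q₁ cm) (q₂ um) with hP₂
  set P₃ : complexBetti (A.prod B).X (2 * (n + 1)) := cupProduct h (q₁ cp) (q₂ um) with hP₃
  set P₄ : complexBetti (A.prod B).X (2 * (n + 1)) := cupProduct h (q₁ cm) (q₂ up) with hP₄
  have hP : P = P₁ + P₂ + P₃ + P₄ := by
    simp only [hPdef, hP₁, hP₂, hP₃, hP₄, hq₁, hq₂, map_add, LinearMap.add_apply]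
    abel
  have e₁ : T P₁ = (sp ^ (2 * n) * sp ^ (2 * 1)) • P₁ :=
    map_one_add_cupProduct_fst_snd h h₁ h₂ hcp hup
  have e₂ : T P₂ = (sm ^ (2 * n) * sm ^ (2 * 1)) • P₂ :=
    map_one_add_cupProduct_fst_snd h h₁ h₂ hcm hum
  have e₃ : T P₃ = (sp ^ (2 * n) * sm ^ (2 * 1)) • P₃ :=
    map_one_add_cupProduct_fst_snd h h₁ h₂ hcp hum
  have e₄ : T P₄ = (sm ^ (2 * n) * sp ^ (2 * 1)) • P₄ :=
    map_one_add_cupProduct_fst_snd h h₁ h₂ hcm hup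
  -- the eigenvalues and the projector `Q = q(T) P`, `q(X) = (X - β)(X - β')`
  set α : ℂ := sp ^ (2 * n) * sp ^ (2 * 1) with hα
  set α' : ℂ := sm ^ (2 * n) * sm ^ (2 * 1) with hα'
  set β : ℂ := sp ^ (2 * n) * sm ^ (2 * 1) with hβ
  set β' : ℂ := sm ^ (2 * n) * sp ^ (2 * 1) with hβ'
  have hαpow : α = sp ^ (2 * (n + 1)) := by rw [hα, ← pow_add, h]
  have hα'pow : α' = sm ^ (2 * (n + 1)) := by rw [hα', ← pow_add, h]
  set Q : complexBetti (A.prod B).X (2 * (n + 1)) := T (T P) - (β + β') • T P + (β * β') • P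
    with hQdef
  have hQ : Q = ((α - β) * (α - β')) • P₁ + ((α' - β) * (α' - β')) • P₂ := by
    rw [hQdef]
    exact weilProjector_eq T hP e₁ e₂ e₃ e₄
  have hTQ : T Q = (α * ((α - β) * (α - β'))) • P₁ + (α' * ((α' - β) * (α' - β'))) • P₂ := by
    rw [hQdef]
    exact weilProjector_map_eq T hP e₁ e₂ e₃ e₄
  -- `P₁`, `P₂` are eigenvectors of `T` for the two Weil eigenvalues of the product
  have hP₁E : P₁ ∈ Module.End.eigenspace T (sp ^ (2 * (n + 1))) := by
    rw [Module.End.mem_eigenspace_iff, e₁, hαpow]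
  have hP₂E : P₂ ∈ Module.End.eigenspace T (sm ^ (2 * (n + 1))) := by
    rw [Module.End.mem_eigenspace_iff, e₂, hα'pow]
  have hQW : Q ∈ Module.End.eigenspace T (sp ^ (2 * (n + 1))) ⊔
      Module.End.eigenspace T (sm ^ (2 * (n + 1))) := by
    rw [hQ]
    exact Submodule.add_mem _ (Submodule.mem_sup_left (Submodule.smul_mem _ _ hP₁E))
      (Submodule.mem_sup_right (Submodule.smul_mem _ _ hP₂E))
  have hTQW : T Q ∈ Module.End.eigenspace T (sp ^ (2 * (n + 1))) ⊔
      Module.End.eigenspace T (sm ^ (2 * (n + 1))) := by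
    rw [hTQ]
    exact Submodule.add_mem _ (Submodule.mem_sup_left (Submodule.smul_mem _ _ hP₁E))
      (Submodule.mem_sup_right (Submodule.smul_mem _ _ hP₂E))
  -- `Q` and `TQ` are rational: `P` is, `T` preserves rationality, `β + β' ∈ ℤ`, `ββ' ∈ ℤ`
  have hPr : IsRationalClass P := (hr₁.map _).cup h (hr₂.map _)
  have hTPr : IsRationalClass (T P) := by rw [hTapp]; exact hPr.map _
  have hTTPr : IsRationalClass (T (T P)) := by rw [hTapp]; exact hTPr.map _
  have hsum : sp + sm = ((2 : ℤ) : ℂ) := by rw [hsp, hsm]; push_cast; ring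
  have hprod : sp * sm = ((1 + p : ℤ) : ℂ) := by
    have e := natCast_add_mul_natCast_sub 1 p
    simp only [Nat.cast_one, one_pow] at e
    rw [hsp, hsm, e]
  obtain ⟨zs, hzs⟩ : ∃ z : ℤ, (z : ℂ) = β + β' :=
    exists_intCast_eq_pow_mul_pow_add hsum hprod (2 * n) (2 * 1)
  obtain ⟨zt, hzt⟩ : ∃ z : ℤ, (z : ℂ) = β * β' := by
    refine ⟨(1 + p) ^ (2 * n + 2 * 1), ?_⟩
    rw [Int.cast_pow, ← hprod, hβ, hβ']
    ring
  have hQr : IsRationalClass Q := by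
    have e : Q = T (T P) + (((-zs : ℤ) : ℚ) : ℂ) • T P + (((zt : ℤ) : ℚ) : ℂ) • P := by
      rw [hQdef, Rat.cast_intCast, Rat.cast_intCast, Int.cast_neg, hzs, hzt, neg_smul,
        ← sub_eq_add_neg]
    rw [e]
    exact (hTTPr.add (hTPr.smul _)).add (hPr.smul _)
  have hTQr : IsRationalClass (T Q) := by rw [hTapp]; exact hQr.map _
  -- `Q` and `TQ` are of Hodge type `(n+1, n+1)`: work in the witness model of `P`
  obtain ⟨M, hM⟩ := hH
  have hstab : ∀ c : complexBetti (A.prod B).X (2 * (n + 1)),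
      M.pullback (2 * (n + 1)) c ∈ M.hodgePQ (2 * (n + 1)) (n + 1) (n + 1) →
      M.pullback (2 * (n + 1)) (T c) ∈ M.hodgePQ (2 * (n + 1)) (n + 1) (n + 1) := fun c hc ↦ by
    rw [hTapp]
    exact M.pullback_map_mem_hodgePQ_of_endomorphism hBX (𝟙 (A.prod B) + Φ).hom.hom.hom hc
  have hMP : P ∈ (M.hodgePQ (2 * (n + 1)) (n + 1) (n + 1)).comap (M.pullback (2 * (n + 1))).hom := hM
  have hMQ : Q ∈ (M.hodgePQ (2 * (n + 1)) (n + 1) (n + 1)).comap (M.pullback (2 * (n + 1))).hom := by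
    rw [hQdef]
    refine Submodule.add_mem _ (Submodule.sub_mem _ ?_ (Submodule.smul_mem _ _ ?_))
      (Submodule.smul_mem _ _ hMP)
    · exact hstab _ (hstab _ hMP)
    · exact hstab _ hMP
  have hQH : IsOfHodgeType (2 * (n + 1)) (A.prod B).X (2 * (n + 1)) (n + 1) (n + 1) Q := ⟨M, hMQ⟩
  have hTQH : IsOfHodgeType (2 * (n + 1)) (A.prod B).X (2 * (n + 1)) (n + 1) (n + 1) (T Q) :=
    ⟨M, hstab _ hMQ⟩
  -- hence both are algebraic, and so are `P₁`, `P₂`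
  have hQalg : Q ∈ algebraicClasses (A.prod B).X (n + 1) := hB Q hQr hQH hQW
  have hTQalg : T Q ∈ algebraicClasses (A.prod B).X (n + 1) := hB (T Q) hTQr hTQH hTQW
  rw [hQ] at hQalg
  rw [hTQ] at hTQalg
  have hne : α ≠ α' := by rwa [hαpow, hα'pow]
  refine mem_and_mem_of_smul_add_smul_mem (algebraicClasses (A.prod B).X (n + 1)) hne ?_ ?_
    hQalg hTQalg
  · refine mul_ne_zero ?_ ?_
    · rw [hα, hβ, ← mul_sub]
      exact mul_ne_zero (pow_ne_zero _ hsp0) (sub_ne_zero.mpr hx₂)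
    · rw [hα, hβ', ← sub_mul]
      exact mul_ne_zero (sub_ne_zero.mpr hx₁) (pow_ne_zero _ hsp0)
  · refine mul_ne_zero ?_ ?_
    · rw [hα', hβ, ← sub_mul]
      exact mul_ne_zero (sub_ne_zero.mpr hx₁.symm) (pow_ne_zero _ hsm0)
    · rw [hα', hβ', ← mul_sub]
      exact mul_ne_zero (pow_ne_zero _ hsm0) (sub_ne_zero.mpr hx₂.symm)

/-! ### Fibre integrals along `complexGysin` (input of the downward half) -/

/-- **A non-zero top class of `Z` has non-zero fibre integral over `X × Z → X`.** For smooth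
projective complex `X` (dimension `l`) and `Z` (dimension `n`), an orientation family `μ` and
`0 ≠ w ∈ H²ⁿ(Z(ℂ); ℂ)`, the degree-`0` class `(pr_X)_* pr_Z^* w ∈ H⁰(X(ℂ); ℂ)` is non-zero, GRANTED
that the cross products `pr_X^* a ∪ pr_Z^* w'` span `H^{2(l+n)}((X × Z)(ℂ); ℂ)` (Künneth, top degree).
Proof: if it vanished, then `⟨pr_X^* a ∪ pr_Z^* w', [X × Z]⟩ = ⟨a, (pr_X)_* pr_Z^* w' ⌢ [X]⟩ = 0` for
all top `a` and all `w' ∈ H²ⁿ(Z(ℂ)) = ℂ · w` (`exists_eq_smul_of_top`; graded commutativity,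
`⟨s ∪ t, σ⟩ = ⟨t, s ⌢ σ⟩`, naturality, and the defining square of `complexGysin`); cross products of
the other bidegrees vanish, so the Kronecker pairing with `[X × Z] ≠ 0` would kill all of
`H^{2(l+n)}`, contradicting universal coefficients over `ℂ` (`kroneckerPairing_surjective`). -/
theorem complexGysin_fst_map_snd_ne_zero_of_kunneth (μ : OrientationFamily) {l n : ℕ}
    {X Z : Motives.SchemeOver ℂ} (hX : Motives.IsSmoothProjective l X)
    (hZ : Motives.IsSmoothProjective n Z)
    (hK : ∀ z : complexBetti (X ⊗ Z) (2 * (l + n)), z ∈ Submodule.span ℂ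
      {v | ∃ (i j : ℕ) (h : i + j = 2 * (l + n)) (a : complexBetti X i) (w : complexBetti Z j),
        v = cupProduct h (complexBetti.map (fst X Z) i a) (complexBetti.map (snd X Z) j w)})
    {w : complexBetti Z (2 * n)} (hw : w ≠ 0) :
    complexGysin μ (Motives.IsSmoothProjective.tensor_holds hX hZ) hX (fst X Z)
        (show 2 * n + 2 * l = 0 + 2 * (l + n) by omega) (complexBetti.map (snd X Z) (2 * n) w) ≠ 0 := by
  have hμ : μ.HasPoincareDuality := OrientationFamily.hasPoincareDuality μ
  have hT := Motives.IsSmoothProjective.tensor_holds hX hZ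
  letI := hT.chartedSpace
  haveI := Motives.ComplexPoints.compactSpace_of_isSmoothProjective hT
  haveI := Motives.ComplexPoints.t2Space_of_isSmoothProjective hT
  haveI := connectedSpace_complexPoints hT
  intro h0
  set κ := kroneckerPairing ℂ ℂ (Motives.ComplexPoints (X ⊗ Z)) (2 * (l + n)) with hκ
  have hne : (μ hT).fundamentalClass ≠ 0 := fundamentalClass_ne_zero (μ hT)
  obtain ⟨θ, hθ⟩ : ∃ θ : Module.Dual ℂ (singularHomology ℂ ℂ (Motives.ComplexPoints (X ⊗ Z))
      (2 * (l + n))), θ (μ hT).fundamentalClass ≠ 0 := by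
    by_contra h
    push Not at h
    exact hne ((Module.forall_dual_apply_eq_zero_iff ℂ _).1 h)
  obtain ⟨G₀, hG₀⟩ := kroneckerPairing_surjective ℂ (Motives.ComplexPoints (X ⊗ Z)) (2 * (l + n)) θ
  have hG₀ne : κ G₀ (μ hT).fundamentalClass ≠ 0 := by rw [hκ, hG₀]; exact hθ
  apply hG₀ne
  -- every top-degree cross product `fst^* a ∪ snd^* w'`, `w' ∈ H²ⁿ(Z(ℂ)) = ℂ · w`, pairs to zero with `[T]`
  have key : ∀ (a : complexBetti X (2 * l)) (w' : complexBetti Z (2 * n)),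
      κ (cupProduct (two_mul_add_two_mul l n) (complexBetti.map (fst X Z) (2 * l) a)
        (complexBetti.map (snd X Z) (2 * n) w')) (μ hT).fundamentalClass = 0 := by
    intro a w'
    obtain ⟨t, rfl⟩ := exists_eq_smul_of_top μ hZ hw w'
    have hsign : ((-1 : ℂ) ^ (2 * l * (2 * n))) = 1 := Even.neg_one_pow ⟨l * (2 * n), by ring⟩
    rw [map_smul, map_smul, map_smul, LinearMap.smul_apply, smul_eq_mul]
    refine mul_eq_zero_of_right t ?_
    rw [cupProduct_gradedComm_holds ℂ _ _ (show 2 * n + 2 * l = 2 * (l + n) by omega), hsign,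
      one_smul, hκ, kroneckerPairing_cupProduct]
    change kroneckerPairing ℂ ℂ _ _ (singularCohomology.map ℂ ℂ
      (Motives.AlgPoints.mapContinuous (L := ℂ) (fst X Z)) _ a) _ = 0
    rw [kroneckerPairing_map, ← capProduct_complexGysin hμ hT hX (fst X Z)
      (show 2 * n + 2 * l = 0 + 2 * (l + n) by omega) _ (Nat.zero_add _), h0,
      map_zero, LinearMap.zero_apply, map_zero]
  have hle : Submodule.span ℂ {v | ∃ (i j : ℕ) (h : i + j = 2 * (l + n)) (a : complexBetti X i)
        (w : complexBetti Z j),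
        v = cupProduct h (complexBetti.map (fst X Z) i a) (complexBetti.map (snd X Z) j w)} ≤
      LinearMap.ker (κ.flip (μ hT).fundamentalClass) := by
    refine Submodule.span_le.2 ?_
    rintro _ ⟨i, j, h, a, v, rfl⟩
    rw [SetLike.mem_coe, LinearMap.mem_ker, LinearMap.flip_apply]
    rcases lt_trichotomy (2 * l) i with hi | hi | hi
    · haveI := subsingleton_complexBetti hX hi
      rw [Subsingleton.elim a 0, map_zero, map_zero, LinearMap.zero_apply, map_zero,
        LinearMap.zero_apply]
    swap
    · haveI := subsingleton_complexBetti hZ (show 2 * n < j by omega)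
      rw [Subsingleton.elim v 0, map_zero, map_zero, map_zero, LinearMap.zero_apply]
    subst hi
    obtain rfl : j = 2 * n := by omega
    exact key a v
  have hmem := hle (hK G₀)
  rwa [LinearMap.mem_ker, LinearMap.flip_apply] at hmem

end Summit.HodgeConjecture.HodgeConjecture.Theorems

end
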